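import Literature.IUT.HodgeArakelov.ThetaEvaluationSettingRmk221FactRowDecided
import Literature.IUT.HodgeArakelov.CyclicToyEtaleThetaData
import Literature.IUT.HodgeArakelov.DihedralCuspToy
import Literature.IUT.HodgeTheaters.CommensuratorLemmas
import HarnessLib

/-!
# [IUTchII] Remark 2.2.1 (`Rmk221_commTerminal`, FACT-LIST row F-1952): BINDER-FREE instance forms at the tree's
# CLOSED toy decompositions (proof-only)

S. Mochizuki, *Inter-universal Teichmüller theory II: Hodge–Arakelov-theoretic evaluation*, kurims manuscript (Dec.
2020), §2, Remark 2.2.1 p. 67: "since the subgroup `Π_{v▶} ⊆ Π_v` is commensurably terminal [cf. [IUTchI], Corollary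
2.3, (iv)], … the indeterminacy induced on any specific `Π_v`-conjugate of this subgroup `Π_{v▶}` is an indeterminacy
with respect to inner automorphisms" [claim: Mochizuki2012, status: disputed] (IUTchII §2 Rmk 2.2.1, kurims p.67)
(D-0012 claim key; series status DISPUTED; nothing printed is asserted here).  abc-iut cell, block F, KEY INST59L1
(seat abc-iut-f-186 gen 3), FACT-LIST row **F-1952** (print locator of record per abc-iut-L6-lead 2026-08-27T12:19:46Z:
[IUTchII] Rmk 2.2.1 p. 67; node IUTchII:Rmk2.2.1 discharged p407103 + p421254).  PROOF-ONLY companion of abc-iut-L6-t1's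
`ThetaEvaluationSetting.lean` (no `def`, no `instance`, nothing re-typed).

The row is the PARAMETRISED predicate `Rmk221_commTerminal Dec := IsCommensurablyTerminal Dec.Ptri` on the Prop. 2.2
data `Dec : SubgraphDecomposition S T D`.  Kernel status before this file (plan/LF-KERNEL-STATUS.tsv 2026-08-27T12:11Z):
universal closure REFUTED (`not_forall_Rmk221_commTerminal`; `exists_not_Rmk221_commTerminal` at EVERY non-trivial
`Π_v`) · seven conditional closers (`Rmk221_commTerminal_of_cor23i_bridge`, `…_of_refTri`, `…_of_cor23_i_iii`, …) ·
the positive side only INSIDE the `∃`-statement `exists_setting_decided_both_ways` · NO theorem whose HEAD is the row at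
closed data.  This file records closed-head instances at the two CLOSED toy quintuples the tree already has:

* `Rmk221_commTerminal_cyclicToy l p …` / `Rmk221_commTerminal_cyclicToy_three_five` — at abc-iut-w5-d243's CLOSED
  cyclic toy (`CyclicToy.cyclicDecomposition`: `Π_v := 1`, `Π_{v▶} := 1`): the trivial subgroup of the trivial group
  is commensurably terminal.  HONEST LABEL «DEGENERATE toy» (`Π_v = 1`);
* `Rmk221_commTerminal_dihedralToy_top l p …` / `Rmk221_commTerminal_dihedralToy_top_three_five` — at
  abc-iut-w5-d243's DIHEDRAL CUSP TOY (`Π_v := D_{3^l}`, NON-TRIVIAL) with the subgraph decomposition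
  `Π_{v•} = Π_{v▶} := Π_v`, `ι := id`, references `⊤` (the same `Dec` abc-iut-f-130's `exists_not_cor24_i'` uses,
  written inline — this file declares no definition): `Π_v` is commensurably terminal in itself.  HONEST LABEL «TOY;
  `Π_{v▶} = Π_v`» — in a finite group every subgroup is commensurable with all its conjugates, so the ONLY
  commensurably terminal subgroup is the whole group: no finite toy can carry a proper `Π_{v▶}` satisfying the row;
* `Rmk221_commTerminal_decided_closed` — the row decided both ways AT CLOSED DATA over one non-trivial `Π_v`
  (dihedral toy: `Π_{v▶} := Π_v` true, `Π_{v▶} := 1` false).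

The GENUINE instance (a proper decomposition group `Π_{v▶} ⊊ Π^tp_{X̲̲_v}` of the special fibre) is the CONDITIONAL
closer `Rmk221_commTerminal_of_cor23iv_bridge` / `cor23iv_ofSpecialFibre_of_slim` modulo [IUTchI] Cor. 2.3 (iv)'s
inputs (F-2590, F-0438, density, slimness) — open at genuine data, sized by those rows; not repeated here.
An instance-form theorem about OUR typed predicate at OUR toys ≠ the printed remark; typed ≠ proved; refuted-as-typed
(closure) ≠ refuted-in-print; nothing here bears on [IUTchIII] Cor. 3.12 or asserts anything about abc.
-/

noncomputable section

namespace Literature.IUT.HodgeArakelov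

open Literature.AnabelianGeometry.AbsoluteAnabelian (IsCommensurablyTerminal)
open CyclicToy DihedralCuspToy

variable (l p : ℕ) (hl : l.Prime) (hl2 : l ≠ 2) (hp : p.Prime) (hp2 : p ≠ 2) (hpl : p ≠ l)

/-! ### The closed cyclic toy (`Π_v = 1`) -/

/-- **IUTchII:Rmk2.2.1 input HOLDS at the closed cyclic toy** (kurims p.67): for the subgraph decomposition
`CyclicToy.cyclicDecomposition` (`Π_v := 1`, `Π_{v▶} := 1`) the row `Rmk221_commTerminal` is the commensurable
terminality of the trivial subgroup of the TRIVIAL group — true (one-element subgroup lattice).  Instance form of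
F-1952 over the toy's parameters; HONEST LABEL: degenerate toy.
[claim: Mochizuki2012, status: disputed] (IUTchII §2 Rmk 2.2.1, kurims p.67) -/
theorem Rmk221_commTerminal_cyclicToy :
    Literature.IUT.HodgeArakelov.Rmk221_commTerminal (cyclicDecomposition l p hl hl2 hp hp2 hpl) :=
  ⟨Subsingleton.elim _ _⟩

/-- **The CLOSED instance** (`l := 3`, `p := 5`): 0 binders, 0 hypotheses.
[claim: Mochizuki2012, status: disputed] (IUTchII §2 Rmk 2.2.1, kurims p.67) -/
theorem Rmk221_commTerminal_cyclicToy_three_five :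
    Literature.IUT.HodgeArakelov.Rmk221_commTerminal
      (cyclicDecomposition 3 5 Nat.prime_three (by decide) Nat.prime_five (by decide) (by decide)) :=
  Rmk221_commTerminal_cyclicToy 3 5 _ _ _ _ _

/-! ### The dihedral cusp toy (`Π_v = D_{3^l}`, non-trivial) with `Π_{v▶} := Π_v` -/

/-- **IUTchII:Rmk2.2.1 input HOLDS at the dihedral cusp toy with `Π_{v▶} := Π_v`** (kurims p.67): over
`Π_v := D_{3^l}` (discrete dihedral group, NON-TRIVIAL), the tempered coverings `dCoverings`, the degenerate étale-theta
data and the subgraph decomposition `Π_{v•} = Π_{v▶} := Π_v`, `ι := id`, references `⊤` (every `SubgraphDecomposition`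
axiom holds; written inline), the row is the commensurable terminality of `Π_v` in itself — true.  Instance form of
F-1952 over the toy's parameters; HONEST LABEL: toy, `Π_{v▶} = Π_v` (the only commensurably terminal subgroup of a
finite group). [claim: Mochizuki2012, status: disputed] (IUTchII §2 Rmk 2.2.1, kurims p.67) -/
theorem Rmk221_commTerminal_dihedralToy_top :
    Literature.IUT.HodgeArakelov.Rmk221_commTerminal
      ({ Pbullet := ⊤
         Ptri := ⊤
         bullet_le_tri := le_rfl
         tri_le_YL := fun x _ => Subgroup.mem_comap.mpr (Subgroup.mem_top _)
         iota := ContinuousMulEquiv.refl _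
         iota_bullet := Subgroup.map_id ⊤
         iota_tri := Subgroup.map_id ⊤
         iota_Ydd := Subgroup.map_id _
         refTri := ⊤
         refBullet := ⊤
         corresponds := ⟨ContinuousMulEquiv.refl _, 1, by simp, by simp⟩ } :
        SubgraphDecomposition (dBadPlaceSetting l p hl hl2 hp hp2 hpl) (dCoverings l p hl hl2 hp hp2 hpl)
          (degenerateEtaleThetaData (dBadPlaceSetting l p hl hl2 hp hp2 hpl).toThetaSetting)) :=
  ⟨eq_top_iff.mpr (Literature.IUT.HodgeTheaters.le_commensurator ⊤)⟩

/-- **The CLOSED instance over a non-trivial `Π_v`** (`l := 3`, `p := 5`: `Π_v = D_{27}`): 0 binders, 0 hypotheses.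
[claim: Mochizuki2012, status: disputed] (IUTchII §2 Rmk 2.2.1, kurims p.67) -/
theorem Rmk221_commTerminal_dihedralToy_top_three_five :
    Literature.IUT.HodgeArakelov.Rmk221_commTerminal
      ({ Pbullet := ⊤
         Ptri := ⊤
         bullet_le_tri := le_rfl
         tri_le_YL := fun x _ => Subgroup.mem_comap.mpr (Subgroup.mem_top _)
         iota := ContinuousMulEquiv.refl _
         iota_bullet := Subgroup.map_id ⊤
         iota_tri := Subgroup.map_id ⊤
         iota_Ydd := Subgroup.map_id _
         refTri := ⊤
         refBullet := ⊤
         corresponds := ⟨ContinuousMulEquiv.refl _, 1, by simp, by simp⟩ } :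
        SubgraphDecomposition (dBadPlaceSetting 3 5 Nat.prime_three (by decide) Nat.prime_five (by decide) (by decide))
          (dCoverings 3 5 Nat.prime_three (by decide) Nat.prime_five (by decide) (by decide))
          (degenerateEtaleThetaData
            (dBadPlaceSetting 3 5 Nat.prime_three (by decide) Nat.prime_five (by decide) (by decide)).toThetaSetting)) :=
  Rmk221_commTerminal_dihedralToy_top 3 5 _ _ _ _ _

/-! ### Decided both ways at closed data over one non-trivial `Π_v` -/

/-- **F-1952 decided both ways at CLOSED data over the dihedral toy's `Π_v = D_{3^l}`**: with `Π_{v▶} := Π_v` the row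
HOLDS (above) and with the degenerate decomposition `Π_{v▶} := 1` (`CyclicToy.degenerateDecomposition`) it FAILS —
the trivial subgroup of a non-trivial group is not commensurably terminal (abc-iut-w5-d117 / F-lit's
`exists_not_Rmk221_commTerminal`, here at named data). [claim: Mochizuki2012, status: disputed] (IUTchII §2 Rmk 2.2.1, kurims p.67) -/
theorem Rmk221_commTerminal_decided_closed :
    (∃ Dec : SubgraphDecomposition (dBadPlaceSetting l p hl hl2 hp hp2 hpl) (dCoverings l p hl hl2 hp hp2 hpl)
        (degenerateEtaleThetaData (dBadPlaceSetting l p hl hl2 hp hp2 hpl).toThetaSetting),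
        Dec.Ptri = ⊤ ∧ Rmk221_commTerminal Dec) ∧
      ¬ Rmk221_commTerminal
        (degenerateDecomposition (dBadPlaceSetting l p hl hl2 hp hp2 hpl) (dCoverings l p hl hl2 hp hp2 hpl)
          (degenerateEtaleThetaData (dBadPlaceSetting l p hl hl2 hp hp2 hpl).toThetaSetting)) := by
  refine ⟨⟨_, rfl, Rmk221_commTerminal_dihedralToy_top l p hl hl2 hp hp2 hpl⟩, fun h => ?_⟩
  -- `Π_{v▶} := ⊥` in the non-trivial group `D_{3^l}`: its commensurator is everything
  have hbot : Subgroup.Commensurable.commensurator (⊥ : Subgroup (Dm l)) = ⊥ := h.commensurator_eq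
  have hmem : (DihedralGroup.sr 0 : Dm l) ∈ Subgroup.Commensurable.commensurator (⊥ : Subgroup (Dm l)) := by
    rw [Subgroup.Commensurable.commensurator_mem_iff, Subgroup.smul_bot]
  rw [hbot, Subgroup.mem_bot] at hmem
  -- but the reflection `sr 0` has order `2`
  have h2 := DihedralGroup.orderOf_sr (n := 3 ^ l) 0
  rw [hmem, orderOf_one] at h2
  exact absurd h2 (by decide)

end Literature.IUT.HodgeArakelov

end
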